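import Mathlib
import Literature.Analysis.SpecialFunctions.SechCosineTransform
import Literature.Analysis.SpecialFunctions.GammaProductBounds

/-!
# Crux-triage r1-1 of `DrudeDissolution` (stmt-AtomisticToContinuum-12593): the first lemma
`KineticShapeCriterion` of card `kinetic-polymer-gas-on-the-time-axis` is FALSE AS TYPED

The ideator's sketch (`Cruxes/DrudeDissolution/SketchIdeator2.md`, §"First lemma") states

  `KineticShapeCriterion : ∀ σ C, IsFiniteMeasure σ → (∀ t, C t = ∫ cos (ω t) dσ) →
     HasKineticShape C → HasDrudeWindow σ`.

The cosine transform `σ ↦ C` only sees the symmetrisation `½(σ + σ∘neg)` of `σ`, while the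
conclusion is about `σ` itself, so an ASYMMETRIC representing measure refutes it. Witness (all
three definitions below are copied verbatim from the sketch): `σ = sech(ω)·1_{(0,∞)}(ω) dω`, whose
cosine transform is `C(t) = (π/2) sech(πt/2)` by the tree lemma
`Literature.Analysis.SpecialFunctions.integral_cos_div_cosh`; `C` has a kinetic shape with
`ρ = π·δ_{π/2}` (plateau `∫ s⁻¹ dρ = 2`) and even remainder
`E(t) = (π/2) sech(πt/2) − π e^{−π|t|/2}`, `|E(t)| ≤ π e^{−3π|t|/2}`, `∫|E| ≤ 4/3 < 2`; but
`σ((−δ, 0)) = 0` forces every continuous window density `g ≥ 0` to vanish on `(−δ, 0)` and hence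
at `0`, contradicting `0 < g 0`.

REPAIR (what the card should state; the witness misses it): add `σ.map Neg.neg = σ`, or conclude
`HasDrudeWindow` for the symmetrised measure — then the criterion is true (Fourier inversion of an
`L¹` characteristic function), and `KineticShapeDissolution` must produce a symmetric `σ`.
-/

noncomputable section

namespace Summit.AtomisticToContinuum.FouriersLaw.Cruxes.DrudeDissolution.Triage1

open MeasureTheory Set Filter Topology
open scoped ENNReal

/-! ## The three definitions, verbatim from `SketchIdeator2.md` -/

/-- The window conclusion of the crux, factored out (verbatim). -/
def HasDrudeWindow (σ : Measure ℝ) : Prop :=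
  ∃ (δ : ℝ) (g : ℝ → ℝ), 0 < δ ∧ ContinuousOn g (Ioo (-δ) δ) ∧ (∀ ω ∈ Ioo (-δ) δ, 0 ≤ g ω) ∧
    0 < g 0 ∧
    σ.restrict (Ioo (-δ) δ) = (volume.restrict (Ioo (-δ) δ)).withDensity (fun ω => ENNReal.ofReal (g ω))

/-- Kinetic shape of a correlation function (verbatim, v3 floor-free). -/
def HasKineticShape (C : ℝ → ℝ) : Prop :=
  ∃ (ρ : Measure ℝ) (E : ℝ → ℝ), IsFiniteMeasure ρ ∧ ρ (Iic 0) = 0 ∧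
    Integrable (fun s : ℝ => s⁻¹) ρ ∧
    Integrable E volume ∧ (∀ t : ℝ, E (-t) = E t) ∧
    (∀ t : ℝ, 0 ≤ t → C t = (∫ s, Real.exp (-(s * t)) ∂ρ) + E t) ∧
    (∫ t, |E t|) < ∫ s, s⁻¹ ∂ρ

/-- The card's first lemma (verbatim). -/
def KineticShapeCriterion : Prop :=
  ∀ (σ : Measure ℝ) (C : ℝ → ℝ), IsFiniteMeasure σ →
    (∀ t : ℝ, C t = ∫ ω, Real.cos (ω * t) ∂σ) → HasKineticShape C → HasDrudeWindow σ

/-! ## The witness -/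

/-- The asymmetric spectral measure `sech(ω) 1_{ω > 0} dω`. -/
def σw : Measure ℝ :=
  (volume.restrict (Ioi (0 : ℝ))).withDensity fun ω => ENNReal.ofReal (Real.cosh ω)⁻¹

/-- Its cosine transform, in closed form. -/
def Cw (t : ℝ) : ℝ := Real.pi / 2 / Real.cosh (Real.pi * t / 2)

/-- The even remainder of the kinetic shape of `Cw`. -/
def Ew (t : ℝ) : ℝ := Real.pi / 2 / Real.cosh (Real.pi * t / 2) - Real.pi * Real.exp (-(Real.pi / 2 * |t|))

/-- The rate measure of the kinetic shape of `Cw`: mass `π` at rate `π/2`. -/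
def ρw : Measure ℝ := (ENNReal.ofReal Real.pi) • Measure.dirac (Real.pi / 2)

/-! ### Elementary `sech` inequalities -/

theorem inv_cosh_le (y : ℝ) : (Real.cosh y)⁻¹ ≤ 2 * Real.exp (-y) := by
  have hc := Real.cosh_pos y
  rw [inv_le_iff_one_le_mul₀ hc, Real.cosh_eq]
  have h1 : Real.exp (-y) * Real.exp y = 1 := by rw [← Real.exp_add]; simp
  nlinarith [Real.exp_pos (-y), sq_nonneg (Real.exp (-y))]

theorem two_exp_sub_inv_cosh_nonneg (y : ℝ) : 0 ≤ 2 * Real.exp (-y) - (Real.cosh y)⁻¹ := by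
  linarith [inv_cosh_le y]

theorem two_exp_sub_inv_cosh_le (y : ℝ) :
    2 * Real.exp (-y) - (Real.cosh y)⁻¹ ≤ 2 * Real.exp (-(3 * y)) := by
  have hc := Real.cosh_pos y
  have h1 : Real.exp (-y) * Real.exp y = 1 := by rw [← Real.exp_add]; simp
  have h3 : Real.exp (-(3 * y)) = Real.exp (-y) ^ 3 := by
    rw [show -(3 * y) = (3 : ℕ) * (-y) by push_cast; ring, Real.exp_nat_mul]
  rw [h3, sub_le_iff_le_add]
  -- multiply through by cosh y > 0
  rw [← sub_nonneg]
  have key : 2 * Real.exp (-y) ^ 3 + (Real.cosh y)⁻¹ - 2 * Real.exp (-y) =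
      (Real.cosh y)⁻¹ * (2 * Real.exp (-y) ^ 3 * Real.cosh y + 1 - 2 * Real.exp (-y) * Real.cosh y) := by
    field_simp
  rw [key]
  refine mul_nonneg (inv_nonneg.mpr hc.le) ?_
  rw [Real.cosh_eq]
  nlinarith [Real.exp_pos (-y), sq_nonneg (Real.exp (-y)), sq_nonneg (Real.exp (-y) ^ 2), h1]

/-- `|Ew t| ≤ π e^{-3π|t|/2}` and `Ew t ≤ 0`-type control. -/
theorem abs_Ew_le (t : ℝ) : |Ew t| ≤ Real.pi * Real.exp (-(3 * Real.pi / 2 * |t|)) := by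
  set y : ℝ := Real.pi / 2 * |t| with hy
  have hcosh : Real.cosh (Real.pi * t / 2) = Real.cosh y := by
    rw [hy, ← Real.cosh_abs (Real.pi * t / 2)]
    congr 1
    rw [abs_div, abs_mul, abs_of_pos Real.pi_pos, abs_of_pos (by norm_num : (0:ℝ) < 2)]
    ring
  have hE : Ew t = -(Real.pi / 2) * (2 * Real.exp (-y) - (Real.cosh y)⁻¹) := by
    simp only [Ew, hcosh]
    rw [hy]; ring
  rw [hE, abs_mul, abs_neg, abs_of_pos (by positivity : (0:ℝ) < Real.pi / 2),
    abs_of_nonneg (two_exp_sub_inv_cosh_nonneg y)]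
  have h := two_exp_sub_inv_cosh_le y
  have h3 : Real.exp (-(3 * y)) = Real.exp (-(3 * Real.pi / 2 * |t|)) := by
    rw [hy]; ring_nf
  rw [← h3]
  nlinarith [Real.pi_pos, Real.exp_pos (-(3 * y))]

/-! ### The measure `σw` -/

theorem integrable_inv_cosh : Integrable (fun ω : ℝ => (Real.cosh ω)⁻¹) := by
  refine Integrable.mono'
    ((Literature.Analysis.SpecialFunctions.integrable_exp_neg_mul_abs one_pos).const_mul 2)
    (by fun_prop) (Eventually.of_forall fun ω => ?_)
  rw [Real.norm_eq_abs, abs_of_pos (inv_pos.mpr (Real.cosh_pos ω)), one_mul,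
    ← Real.cosh_abs]
  exact inv_cosh_le |ω|

instance : IsFiniteMeasure σw := by
  unfold σw
  exact isFiniteMeasure_withDensity_ofReal integrable_inv_cosh.integrableOn.hasFiniteIntegral

theorem integral_cos_σw (t : ℝ) : ∫ ω, Real.cos (ω * t) ∂σw = Cw t := by
  unfold σw
  rw [integral_withDensity_eq_integral_toReal_smul (f := fun ω => ENNReal.ofReal (Real.cosh ω)⁻¹)
    (ENNReal.measurable_ofReal.comp (by fun_prop)) (Eventually.of_forall fun _ => ENNReal.ofReal_lt_top)]
  have h : ∫ ω in Ioi (0:ℝ), (ENNReal.ofReal (Real.cosh ω)⁻¹).toReal • Real.cos (ω * t) =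
      ∫ ω in Ioi (0:ℝ), Real.cos (t * ω) / Real.cosh (1 * ω) := by
    refine integral_congr_ae (Eventually.of_forall fun ω => ?_)
    simp only [smul_eq_mul, one_mul, ENNReal.toReal_ofReal (inv_nonneg.mpr (Real.cosh_pos ω).le)]
    rw [mul_comm ω t, div_eq_inv_mul]
  rw [h, Literature.Analysis.SpecialFunctions.integral_cos_div_cosh one_pos t, Cw]
  ring_nf

theorem σw_Iic_zero : σw (Iic 0) = 0 := by
  unfold σw
  rw [withDensity_apply _ measurableSet_Iic, Measure.restrict_restrict measurableSet_Iic]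
  have : Iic (0:ℝ) ∩ Ioi 0 = ∅ := by
    ext x; simp
  rw [this, Measure.restrict_empty, lintegral_zero_measure]

/-! ### The kinetic shape of `Cw` -/

instance : IsFiniteMeasure ρw := by
  refine ⟨?_⟩
  simp only [ρw, Measure.smul_apply, smul_eq_mul]
  exact ENNReal.mul_lt_top ENNReal.ofReal_lt_top (measure_lt_top _ _)

theorem ρw_Iic_zero : ρw (Iic 0) = 0 := by
  simp only [ρw, Measure.smul_apply, smul_eq_mul]
  rw [Measure.dirac_apply' _ measurableSet_Iic, Set.indicator_of_notMem]
  · simp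
  · simp only [mem_Iic, not_le]; positivity

theorem integrable_ρw (f : ℝ → ℝ) : Integrable f ρw := by
  unfold ρw
  exact ((integrable_const (f (Real.pi / 2))).congr (ae_eq_dirac f).symm).smul_measure
    ENNReal.ofReal_ne_top

theorem integral_ρw (f : ℝ → ℝ) : ∫ s, f s ∂ρw = Real.pi * f (Real.pi / 2) := by
  unfold ρw
  rw [integral_smul_measure, integral_dirac, ENNReal.toReal_ofReal Real.pi_pos.le, smul_eq_mul]

theorem integral_inv_ρw : ∫ s, s⁻¹ ∂ρw = 2 := by
  rw [integral_ρw]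
  field_simp

theorem Ew_even (t : ℝ) : Ew (-t) = Ew t := by
  simp only [Ew, abs_neg]
  rw [show Real.pi * -t / 2 = -(Real.pi * t / 2) by ring, Real.cosh_neg]

theorem integrable_Cw : Integrable Cw := by
  have hc : (0:ℝ) < Real.pi / 2 := by positivity
  have h := (integrable_inv_cosh.comp_mul_left' hc.ne').const_mul (Real.pi / 2)
  refine h.congr (Eventually.of_forall fun t => ?_)
  simp only [Cw]
  rw [div_eq_mul_inv (Real.pi / 2)]
  congr 2
  ring

theorem integrable_exp_part : Integrable (fun t : ℝ => Real.pi * Real.exp (-(Real.pi / 2 * |t|))) :=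
  (Literature.Analysis.SpecialFunctions.integrable_exp_neg_mul_abs (by positivity)).const_mul _

theorem integrable_Ew : Integrable Ew := by
  have := integrable_Cw.sub integrable_exp_part
  refine this.congr (Eventually.of_forall fun t => ?_)
  simp [Cw, Ew]

theorem Cw_eq (t : ℝ) (ht : 0 ≤ t) : Cw t = (∫ s, Real.exp (-(s * t)) ∂ρw) + Ew t := by
  rw [integral_ρw, Ew, Cw, abs_of_nonneg ht]
  ring

/-- `∫ |E| ≤ 4/3 < 2 = ∫ s⁻¹ dρ`. -/
theorem integral_abs_Ew_lt : (∫ t, |Ew t|) < ∫ s, s⁻¹ ∂ρw := by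
  rw [integral_inv_ρw]
  have hc : (0:ℝ) < 3 * Real.pi / 2 := by positivity
  have hdom : Integrable (fun t : ℝ => Real.pi * Real.exp (-(3 * Real.pi / 2 * |t|))) :=
    (Literature.Analysis.SpecialFunctions.integrable_exp_neg_mul_abs hc).const_mul _
  have h1 : (∫ t, |Ew t|) ≤ ∫ t, Real.pi * Real.exp (-(3 * Real.pi / 2 * |t|)) :=
    integral_mono integrable_Ew.abs hdom fun t => abs_Ew_le t
  have h2 : (∫ t, Real.pi * Real.exp (-(3 * Real.pi / 2 * |t|))) = 4 / 3 := by
    rw [integral_const_mul]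
    have h3 : (∫ t : ℝ, Real.exp (-(3 * Real.pi / 2 * |t|))) =
        2 * ∫ t in Ioi (0:ℝ), Real.exp (-(3 * Real.pi / 2 * t)) :=
      integral_comp_abs (f := fun t => Real.exp (-(3 * Real.pi / 2 * t)))
    rw [h3]
    have h4 := integral_exp_mul_Ioi (a := -(3 * Real.pi / 2)) (by linarith) 0
    simp only [mul_zero, Real.exp_zero, neg_mul] at h4
    rw [h4]
    field_simp
    ring
  linarith

theorem hasKineticShape_Cw : HasKineticShape Cw :=
  ⟨ρw, Ew, inferInstance, ρw_Iic_zero, integrable_ρw _, integrable_Ew, Ew_even, Cw_eq,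
    integral_abs_Ew_lt⟩

/-! ### No Drude window for a measure vanishing on `(−δ, 0)` -/

/-- A measure charging no set `(−δ, 0)` has no continuous window density with `g 0 > 0`. -/
theorem not_hasDrudeWindow_of_Iio {σ : Measure ℝ} (hσ : σ (Iio 0) = 0) : ¬ HasDrudeWindow σ := by
  rintro ⟨δ, g, hδ, hg, hg0, hgpos, hw⟩
  set S : Set ℝ := Ioo (-δ) 0 with hS
  have hSm : MeasurableSet S := measurableSet_Ioo
  have hSsub : S ⊆ Ioo (-δ) δ := Ioo_subset_Ioo le_rfl hδ.le
  -- evaluate the window identity on `S`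
  have hL : σ.restrict (Ioo (-δ) δ) S = 0 := by
    rw [Measure.restrict_apply hSm, inter_eq_left.mpr hSsub]
    exact measure_mono_null (fun x hx => hx.2) hσ
  have hR : (∫⁻ ω in S, ENNReal.ofReal (g ω)) = 0 := by
    have this : σ.restrict (Ioo (-δ) δ) S =
        ((volume.restrict (Ioo (-δ) δ)).withDensity fun ω => ENNReal.ofReal (g ω)) S := by rw [hw]
    rw [hL, withDensity_apply _ hSm, Measure.restrict_restrict hSm, inter_eq_left.mpr hSsub] at this
    exact this.symm
  have hgS : ContinuousOn g S := hg.mono hSsub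
  have hae : (fun ω => ENNReal.ofReal (g ω)) =ᵐ[volume.restrict S] 0 :=
    (lintegral_eq_zero_iff' ((ENNReal.measurable_ofReal.comp_aemeasurable
      (hgS.aemeasurable hSm)))).1 hR
  have hae' : g =ᵐ[volume.restrict S] fun _ => (0:ℝ) := by
    rw [Filter.EventuallyEq, ae_restrict_iff' hSm] at hae ⊢
    filter_upwards [hae] with ω hω hωS
    have h1 : g ω ≤ 0 := by simpa using hω hωS
    exact le_antisymm h1 (hg0 ω (hSsub hωS))
  have hzero : EqOn g (fun _ => (0:ℝ)) S :=
    Measure.eqOn_open_of_ae_eq hae' isOpen_Ioo hgS continuousOn_const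
  -- continuity of `g` at `0` from the left gives `g 0 = 0`
  have hcont : ContinuousAt g 0 :=
    hg.continuousAt (Ioo_mem_nhds (by linarith) hδ)
  have hlim1 : Tendsto g (𝓝[<] (0:ℝ)) (𝓝 (g 0)) := hcont.tendsto.mono_left nhdsWithin_le_nhds
  have hlim2 : Tendsto g (𝓝[<] (0:ℝ)) (𝓝 0) := by
    refine tendsto_const_nhds.congr' ?_
    filter_upwards [Ioo_mem_nhdsLT (by linarith : -δ < (0:ℝ))] with ω hω
    exact (hzero hω).symm
  have := tendsto_nhds_unique hlim1 hlim2
  linarith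

theorem not_hasDrudeWindow_σw : ¬ HasDrudeWindow σw :=
  not_hasDrudeWindow_of_Iio (measure_mono_null Iio_subset_Iic_self σw_Iic_zero)

/-! ## The refutation -/

/-- **`KineticShapeCriterion` is false as typed** (refuted-misstated: the representing measure must
be taken symmetric). -/
theorem not_kineticShapeCriterion : ¬ KineticShapeCriterion := fun h =>
  not_hasDrudeWindow_σw (h σw Cw inferInstance (fun t => (integral_cos_σw t).symm) hasKineticShape_Cw)

end Summit.AtomisticToContinuum.FouriersLaw.Cruxes.DrudeDissolution.Triage1

end
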